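import Summits.KontsevichZagierPeriods.KontsevichZagierPeriods.Theorems.HurwitzMicroSectorsNormalFormPrincipleDilogExistsBoxAtoms
import Summits.KontsevichZagierPeriods.KontsevichZagierPeriods.Theorems.HurwitzMicroSectorsNormalFormPrincipleLevelOneExistsRepDim

/-!
# `NormalFormPrinciple` (stmt-KontsevichZagierPeriods-3869), line `SketchIdeator1` —
# leaf `stub_boxRigidity`, layer M3 (EulerBoxDuality): duality and the two rule-(1b) splits

Pure proof file (registered sub-goal `ebd_duality_and_splits` of the layer `M3`, lead seat c9;
`--supports` the crux). In the instance EulerBoxDuality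
`[(0,1)³, 1/((1−xy)(1−xyz))] ∼ [(0,1)³, 2/(1−xyz)]` (Euler's `ζ(2,1) = ζ(3)` in box form) the
simplex chart `t = (x₀, x₀x₁, x₀x₁x₂)` carries the open unit box `□³ = (0,1)³` onto the decreasing
open simplex `Δ = {0 < t₂ < t₁ < t₀ < 1}` and the integrand onto `F = 1/(t₀ t₁ (1 − t₁)(1 − t₂))`,
which splits as `F = G + H` with `G = 1/(t₀ t₁ (1 − t₂))` (the iterated integral `∫ ω₀ω₀ω₁ = ζ(3)`)
and `H = 1/(t₀ (1 − t₁)(1 − t₂))` (`∫ ω₀ω₁ω₁ = ζ(2,1)`). This file proves the four elementary facts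
consumed by the lead's assembly:

1. **duality** `[Δ, H] − [Δ, G] ∈ KZ.relations` as ONE change of variables (rule (2),
   `KZ.changeOfVariablesRel`) along the affine involution `ι(t) = (1 − t₂, 1 − t₁, 1 − t₀)` of `Δ`:
   a `ℚ`-polynomial map with constant derivative `!![0, 0, −1; 0, −1, 0; −1, 0, 0]` of determinant
   `1`, `ι ∘ ι = id` (so `ι` is injective and `ι '' Δ = Δ`), and `G ∘ ι = H` on `Δ`;
2. the partial-fraction split `[Δ, F] − [Δ, G] − [Δ, H] ∈ KZ.relations` (rule (1b),
   `KZ.integrandAddRel`: `1/(t₁(1 − t₁)) = 1/t₁ + 1/(1 − t₁)`);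
3. `[□³, 2/(1 − x₀x₁x₂)] − 2·[□³, 1/(1 − x₀x₁x₂)] ∈ KZ.relations` (rule (1b) with the carrier
   `Z + Z`, plus congruence of integrands on the domain, `KZ.of_sub_of_mem_relations_of_eqOn`);
4. existence of the `ζ(3)` box `Z = [□³, 1/(1 − x₀x₁x₂)]` (the level-one tower in dimension `3`,
   `LevelOne.isSemialgebraicFunOn_aeval_div_one_sub_prod_dim` and
   `LevelOne.integrableOn_aeval_div_one_sub_prod_dim`, seat c7).

References: M. Kontsevich, D. Zagier, *Periods* (2001), §1.1–1.2, rules (1)–(2). No definitions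
are introduced.
-/

noncomputable section

open MeasureTheory Set
open Literature.NumberTheory.Transcendental Literature.NumberTheory.Transcendental.KZ
open Literature.ModelTheory.ExponentialFields (IsSemialgebraic)

namespace Summit.KontsevichZagierPeriods.HurwitzMicroSectors.NormalFormPrinciple.PiBox.M3

/-! ## The affine involution `ι(t) = (1 − t₂, 1 − t₁, 1 − t₀)` -/

/-- **The duality chart.** The affine involution `ι(t) = (1 − t₂, 1 − t₁, 1 − t₀)` of `ℝ³`: its
components, `ℚ`-semialgebraicity on every `ℚ`-semialgebraic set (it is a `ℚ`-polynomial map),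
differentiability with the constant derivative `!![0, 0, −1; 0, −1, 0; −1, 0, 0]`, `ι ∘ ι = id`,
and `det Dι = 1`. [folklore] -/
theorem ebd3_exists_dualityChart :
    ∃ (Φ : (Fin 3 → ℝ) → (Fin 3 → ℝ)) (Φ' : (Fin 3 → ℝ) → (Fin 3 → ℝ) →L[ℝ] (Fin 3 → ℝ)),
      (∀ t, Φ t 0 = 1 - t 2) ∧ (∀ t, Φ t 1 = 1 - t 1) ∧ (∀ t, Φ t 2 = 1 - t 0) ∧
      (∀ σ : Set (Fin 3 → ℝ), IsSemialgebraic ℚ σ → IsSemialgebraicMapOn ℚ σ Φ) ∧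
      (∀ t, HasFDerivAt Φ (Φ' t) t) ∧ (∀ t, Φ (Φ t) = t) ∧ (∀ t, (Φ' t).det = 1) := by
  set A : (Fin 3 → ℝ) →L[ℝ] (Fin 3 → ℝ) :=
    LinearMap.toContinuousLinearMap (Matrix.toLin' !![(0:ℝ), 0, -1; 0, -1, 0; -1, 0, 0])
  set Φ : (Fin 3 → ℝ) → (Fin 3 → ℝ) := fun t => (fun _ => (1:ℝ)) + A t
  have hA0 : ∀ v : Fin 3 → ℝ, A v 0 = -v 2 := by
    intro v
    change Matrix.toLin' !![(0:ℝ), 0, -1; 0, -1, 0; -1, 0, 0] v 0 = _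
    rw [Matrix.toLin'_apply]
    simp [Matrix.mulVec, dotProduct, Fin.sum_univ_three]
  have hA1 : ∀ v : Fin 3 → ℝ, A v 1 = -v 1 := by
    intro v
    change Matrix.toLin' !![(0:ℝ), 0, -1; 0, -1, 0; -1, 0, 0] v 1 = _
    rw [Matrix.toLin'_apply]
    simp [Matrix.mulVec, dotProduct, Fin.sum_univ_three]
  have hA2 : ∀ v : Fin 3 → ℝ, A v 2 = -v 0 := by
    intro v
    change Matrix.toLin' !![(0:ℝ), 0, -1; 0, -1, 0; -1, 0, 0] v 2 = _
    rw [Matrix.toLin'_apply]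
    simp [Matrix.mulVec, dotProduct, Fin.sum_univ_three]
  have hΦ0 : ∀ t, Φ t 0 = 1 - t 2 := fun t => by
    show 1 + A t 0 = 1 - t 2
    rw [hA0, sub_eq_add_neg]
  have hΦ1 : ∀ t, Φ t 1 = 1 - t 1 := fun t => by
    show 1 + A t 1 = 1 - t 1
    rw [hA1, sub_eq_add_neg]
  have hΦ2 : ∀ t, Φ t 2 = 1 - t 0 := fun t => by
    show 1 + A t 2 = 1 - t 0
    rw [hA2, sub_eq_add_neg]
  refine ⟨Φ, fun _ => A, hΦ0, hΦ1, hΦ2, fun σ hσ => ?_,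
    fun t => A.hasFDerivAt.const_add (fun _ : Fin 3 => (1:ℝ)), fun t => ?_, fun t => ?_⟩
  · -- a `ℚ`-polynomial map is `ℚ`-semialgebraic
    refine (isSemialgebraicMapOn_aeval hσ
      ![1 - MvPolynomial.X 2, 1 - MvPolynomial.X 1,
        (1 - MvPolynomial.X 0 : MvPolynomial (Fin 3) ℚ)]).congr fun t _ => ?_
    funext j
    fin_cases j <;> simp [hΦ0, hΦ1, hΦ2]
  · -- involution
    funext j
    fin_cases j <;> simp [hΦ0, hΦ1, hΦ2]
  · -- the Jacobian determinant
    change LinearMap.det (Matrix.toLin' !![(0:ℝ), 0, -1; 0, -1, 0; -1, 0, 0]) = 1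
    rw [LinearMap.det_toLin', Matrix.det_fin_three]
    simp

/-! ## Part 1: duality as ONE rule-(2) move -/

/-- **Duality of the weight-three iterated integrals as one change of variables.** For
representations `TG = [Δ, 1/(t₀ t₁ (1 − t₂))]` and `TH = [Δ, 1/(t₀ (1 − t₁)(1 − t₂))]` on the
decreasing open simplex `Δ = {0 < t₂ < t₁ < t₀ < 1}`, `[TH] − [TG]` is ONE change-of-variables
move of the Kontsevich–Zagier calculus along the affine involution
`ι(t) = (1 − t₂, 1 − t₁, 1 − t₀)` (`ebd3_exists_dualityChart`): `ι` maps `Δ` onto itself, and the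
pull-back identity `TH.integrand t = TG.integrand (ι t) · |det Dι|` on `Δ` reads
`1/(t₀ (1 − t₁)(1 − t₂)) = 1/((1 − t₂)(1 − t₁)(1 − (1 − t₀))) · 1`.
[cite: KontsevichZagier2001, §1.2 rule (2)] -/
theorem ebd3_duality (TG TH : IntegralRep 3)
    (hTGd : TG.domain = {t | 0 < t 2 ∧ t 2 < t 1 ∧ t 1 < t 0 ∧ t 0 < 1})
    (hTGi : EqOn TG.integrand (fun t => 1 / (t 0 * t 1 * (1 - t 2))) TG.domain)
    (hTHd : TH.domain = {t | 0 < t 2 ∧ t 2 < t 1 ∧ t 1 < t 0 ∧ t 0 < 1})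
    (hTHi : EqOn TH.integrand (fun t => 1 / (t 0 * (1 - t 1) * (1 - t 2))) TH.domain) :
    of TH - of TG ∈ relations := by
  obtain ⟨Φ, Φ', hΦ0, hΦ1, hΦ2, hsa, hderiv, hinv, hdet⟩ := ebd3_exists_dualityChart
  -- `ι` maps `Δ` into `Δ`, hence (being an involution) onto `Δ`, injectively
  have hmaps : ∀ t ∈ TH.domain, Φ t ∈ TH.domain := by
    intro t ht
    rw [hTHd] at ht ⊢
    obtain ⟨h2, h21, h10, h01⟩ := ht
    simp only [mem_setOf_eq, hΦ0, hΦ1, hΦ2]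
    exact ⟨by linarith, by linarith, by linarith, by linarith⟩
  have hfix : Φ '' TH.domain = TH.domain := by
    refine Subset.antisymm ?_ fun y hy => ⟨Φ y, hmaps y hy, hinv y⟩
    rintro _ ⟨t, ht, rfl⟩
    exact hmaps t ht
  have himage : TG.domain = Φ '' TH.domain := by rw [hfix, hTGd, hTHd]
  have hinj : InjOn Φ TH.domain := fun x _ y _ hxy =>
    (hinv x).symm.trans (by rw [hxy]; exact hinv y)
  refine changeOfVariablesRel_subset_relations
    ⟨3, TH, TG, Φ, Φ', hsa _ TH.isSemialgebraic_domain, fun t _ => (hderiv t).hasFDerivWithinAt,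
      hinj, himage, fun t ht => ?_, rfl⟩
  -- the pull-back identity on `Δ`, Jacobian `|det Dι| = 1` included
  have hΦt : Φ t ∈ TG.domain := himage ▸ mem_image_of_mem _ ht
  rw [hTHi ht, hTGi hΦt, hdet t, abs_one, mul_one]
  simp only [hΦ0, hΦ1, hΦ2, sub_sub_cancel]
  ring

/-! ## Part 2: the partial-fraction split (rule 1b) -/

/-- The partial-fraction identity behind `F = G + H`:
`1/(u v (1 − v)(1 − w)) = 1/(u v (1 − w)) + 1/(u (1 − v)(1 − w))` for non-vanishing factors.
[folklore] -/
theorem ebd3_partialFraction {u v w : ℝ} (hu : u ≠ 0) (hv : v ≠ 0) (hv' : 1 - v ≠ 0)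
    (hw : 1 - w ≠ 0) :
    1 / (u * v * (1 - v) * (1 - w)) = 1 / (u * v * (1 - w)) + 1 / (u * (1 - v) * (1 - w)) := by
  rw [div_add_div _ _ (mul_ne_zero (mul_ne_zero hu hv) hw) (mul_ne_zero (mul_ne_zero hu hv') hw),
    div_eq_div_iff (mul_ne_zero (mul_ne_zero (mul_ne_zero hu hv) hv') hw)
      (mul_ne_zero (mul_ne_zero (mul_ne_zero hu hv) hw) (mul_ne_zero (mul_ne_zero hu hv') hw))]
  ring

/-- **The split `[Δ, F] − [Δ, G] − [Δ, H]` is one integrand-additivity move.** For representations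
`TF = [Δ, 1/(t₀ t₁ (1 − t₁)(1 − t₂))]`, `TG = [Δ, 1/(t₀ t₁ (1 − t₂))]`, `TH = [Δ, 1/(t₀ (1 − t₁)(1 − t₂))]`
on the decreasing open simplex `Δ`, `[TF] − [TG] − [TH] ∈ KZ.integrandAddRel ⊆ KZ.relations`: the
three domains coincide and `TF.integrand = TG.integrand + TH.integrand` on `Δ` by partial
fractions (`ebd3_partialFraction`; on `Δ` one has `t₀, t₁, 1 − t₁, 1 − t₂ ≠ 0`).
[cite: KontsevichZagier2001, §1.2 rule (1)] -/
theorem ebd3_split (TF TG TH : IntegralRep 3)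
    (hTFd : TF.domain = {t | 0 < t 2 ∧ t 2 < t 1 ∧ t 1 < t 0 ∧ t 0 < 1})
    (hTFi : EqOn TF.integrand (fun t => 1 / (t 0 * t 1 * (1 - t 1) * (1 - t 2))) TF.domain)
    (hTGd : TG.domain = {t | 0 < t 2 ∧ t 2 < t 1 ∧ t 1 < t 0 ∧ t 0 < 1})
    (hTGi : EqOn TG.integrand (fun t => 1 / (t 0 * t 1 * (1 - t 2))) TG.domain)
    (hTHd : TH.domain = {t | 0 < t 2 ∧ t 2 < t 1 ∧ t 1 < t 0 ∧ t 0 < 1})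
    (hTHi : EqOn TH.integrand (fun t => 1 / (t 0 * (1 - t 1) * (1 - t 2))) TH.domain) :
    of TF - of TG - of TH ∈ relations := by
  refine integrandAddRel_subset_relations
    ⟨3, TF, TG, TH, hTGd.trans hTFd.symm, hTHd.trans hTFd.symm, fun t ht => ?_, rfl⟩
  have ht' : 0 < t 2 ∧ t 2 < t 1 ∧ t 1 < t 0 ∧ t 0 < 1 := by rw [hTFd] at ht; exact ht
  obtain ⟨h2, h21, h10, h01⟩ := ht'
  have htG : t ∈ TG.domain := by rw [hTGd]; exact ⟨h2, h21, h10, h01⟩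
  have htH : t ∈ TH.domain := by rw [hTHd]; exact ⟨h2, h21, h10, h01⟩
  show TF.integrand t = TG.integrand t + TH.integrand t
  rw [hTFi ht, hTGi htG, hTHi htH]
  exact ebd3_partialFraction (by linarith) (by linarith) (by linarith) (by linarith)

/-! ## Part 3: `[□³, 2/(1 − x₀x₁x₂)] − 2·[□³, 1/(1 − x₀x₁x₂)]` (rule 1b) -/

/-- **Doubling the `ζ(3)` box is a relation.** For representations `r' = [□³, 2/(1 − x₀x₁x₂)]`
and `Z = [□³, 1/(1 − x₀x₁x₂)]` on the open unit box, `[r'] − 2[Z] ∈ KZ.relations`: with the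
carrier `ZZ = [□³, Z.integrand + Z.integrand]`, `[ZZ] − [Z] − [Z]` is one integrand-additivity
move and `[r'] − [ZZ]` is a congruence of integrands on the domain
(`KZ.of_sub_of_mem_relations_of_eqOn`, `2/q = 1/q + 1/q`). [cite: KontsevichZagier2001, §1.2 rule (1)] -/
theorem ebd3_double (r' Z : IntegralRep 3)
    (hr'd : r'.domain = {x | ∀ i, x i ∈ Set.Ioo (0:ℝ) 1})
    (hr'i : EqOn r'.integrand (fun x => 2 / (1 - x 0 * x 1 * x 2)) r'.domain)
    (hZd : Z.domain = {x | ∀ i, x i ∈ Set.Ioo (0:ℝ) 1})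
    (hZi : EqOn Z.integrand (fun x => 1 / (1 - x 0 * x 1 * x 2)) Z.domain) :
    of r' - 2 • of Z ∈ relations := by
  let ZZ : IntegralRep 3 :=
    ⟨Z.domain, fun x => Z.integrand x + Z.integrand x, Z.isSemialgebraic_domain,
      (IsSemialgebraicFunOn.add_holds Z.isSemialgebraicFunOn_integrand
        Z.isSemialgebraicFunOn_integrand).congr fun _ _ => rfl,
      Z.integrableOn.add Z.integrableOn⟩
  have h1 : of ZZ - of Z - of Z ∈ relations :=
    integrandAddRel_subset_relations ⟨3, ZZ, Z, Z, rfl, rfl, fun _ _ => rfl, rfl⟩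
  have h2 : of r' - of ZZ ∈ relations := by
    refine of_sub_of_mem_relations_of_eqOn (hZd.trans hr'd.symm) fun x hx => ?_
    have hxZ : x ∈ Z.domain := by rw [hZd, ← hr'd]; exact hx
    calc r'.integrand x = 2 / (1 - x 0 * x 1 * x 2) := hr'i hx
      _ = 1 / (1 - x 0 * x 1 * x 2) + 1 / (1 - x 0 * x 1 * x 2) := by ring
      _ = Z.integrand x + Z.integrand x := by rw [hZi hxZ]
  have e : of r' - 2 • of Z = (of r' - of ZZ) + (of ZZ - of Z - of Z) := by
    simp only [two_smul]; abel
  rw [e]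
  exact relations.add_mem h2 h1

/-! ## Part 4: the `ζ(3)` box exists -/

/-- **The `ζ(3)` box exists.** `Z = [(0,1)³, 1/(1 − x₀x₁x₂)]` is an integral representation of
the Kontsevich–Zagier calculus (value `ζ(3)`): the open unit box is `ℚ`-semialgebraic, and the
integrand is the level-one integrand `P/(1 − x₀x₁x₂)` with `P = 1`, hence `ℚ`-semialgebraic and
absolutely integrable on the box (`LevelOne.isSemialgebraicFunOn_aeval_div_one_sub_prod_dim`,
`LevelOne.integrableOn_aeval_div_one_sub_prod_dim`). [cite: KontsevichZagier2001, §1.1] -/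
theorem ebd3_exists_zetaThreeBox :
    ∃ Z : IntegralRep 3, Z.domain = {x | ∀ i, x i ∈ Set.Ioo (0:ℝ) 1} ∧
      Z.integrand = fun x => 1 / (1 - x 0 * x 1 * x 2) := by
  have he : ∀ x : Fin 3 → ℝ,
      (MvPolynomial.aeval x (1 : MvPolynomial (Fin 3) ℚ) : ℝ) / (1 - ∏ i, x i) =
        1 / (1 - x 0 * x 1 * x 2) := fun x => by
    rw [map_one, Fin.prod_univ_three]
  have hsa : IsSemialgebraicFunOn ℚ {x : Fin 3 → ℝ | ∀ i, x i ∈ Set.Ioo (0:ℝ) 1}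
      (fun x => 1 / (1 - x 0 * x 1 * x 2)) :=
    (LevelOne.isSemialgebraicFunOn_aeval_div_one_sub_prod_dim (w := 3) (by norm_num) 1).congr
      fun x _ => he x
  have hint : IntegrableOn (fun x : Fin 3 → ℝ => 1 / (1 - x 0 * x 1 * x 2))
      {x | ∀ i, x i ∈ Set.Ioo (0:ℝ) 1} :=
    (LevelOne.integrableOn_aeval_div_one_sub_prod_dim (w := 3) (by norm_num) 1).congr_fun
      (fun x _ => he x) (isSemialgebraic_box 3).measurableSet_holds
  exact ⟨⟨_, _, isSemialgebraic_box 3, hsa, hint⟩, rfl, rfl⟩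

/-! ## The registered sub-goal -/

/-- **Stub E3 (`ebd_duality_and_splits`; registered sub-goal of stmt-KontsevichZagierPeriods-3869,
line `SketchIdeator1`, layer `M3`, instance EulerBoxDuality).** On the decreasing open simplex
`Δ = {0 < t₂ < t₁ < t₀ < 1} ⊆ ℝ³` and the open unit box `□³`: (1) duality
`[Δ, 1/(t₀(1 − t₁)(1 − t₂))] − [Δ, 1/(t₀t₁(1 − t₂))] ∈ KZ.relations`, ONE change of variables
along the affine involution `t ↦ (1 − t₂, 1 − t₁, 1 − t₀)` (`ebd3_duality`); (2) the
partial-fraction split `[Δ, 1/(t₀t₁(1 − t₁)(1 − t₂))] − [Δ, G] − [Δ, H] ∈ KZ.relations`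
(`ebd3_split`); (3) `[□³, 2/(1 − x₀x₁x₂)] − 2·[□³, 1/(1 − x₀x₁x₂)] ∈ KZ.relations`
(`ebd3_double`); (4) the `ζ(3)` box `[□³, 1/(1 − x₀x₁x₂)]` exists (`ebd3_exists_zetaThreeBox`).
[cite: KontsevichZagier2001, §1.2 rules (1)–(2)] -/
theorem ebd_duality_and_splits :
    (∀ (TG TH : IntegralRep 3),
      TG.domain = {t | 0 < t 2 ∧ t 2 < t 1 ∧ t 1 < t 0 ∧ t 0 < 1} →
      EqOn TG.integrand (fun t => 1 / (t 0 * t 1 * (1 - t 2))) TG.domain →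
      TH.domain = {t | 0 < t 2 ∧ t 2 < t 1 ∧ t 1 < t 0 ∧ t 0 < 1} →
      EqOn TH.integrand (fun t => 1 / (t 0 * (1 - t 1) * (1 - t 2))) TH.domain →
      of TH - of TG ∈ relations) ∧
    (∀ (TF TG TH : IntegralRep 3),
      TF.domain = {t | 0 < t 2 ∧ t 2 < t 1 ∧ t 1 < t 0 ∧ t 0 < 1} →
      EqOn TF.integrand (fun t => 1 / (t 0 * t 1 * (1 - t 1) * (1 - t 2))) TF.domain →
      TG.domain = {t | 0 < t 2 ∧ t 2 < t 1 ∧ t 1 < t 0 ∧ t 0 < 1} →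
      EqOn TG.integrand (fun t => 1 / (t 0 * t 1 * (1 - t 2))) TG.domain →
      TH.domain = {t | 0 < t 2 ∧ t 2 < t 1 ∧ t 1 < t 0 ∧ t 0 < 1} →
      EqOn TH.integrand (fun t => 1 / (t 0 * (1 - t 1) * (1 - t 2))) TH.domain →
      of TF - of TG - of TH ∈ relations) ∧
    (∀ (r' Z : IntegralRep 3),
      r'.domain = {x | ∀ i, x i ∈ Set.Ioo (0:ℝ) 1} →
      EqOn r'.integrand (fun x => 2 / (1 - x 0 * x 1 * x 2)) r'.domain →
      Z.domain = {x | ∀ i, x i ∈ Set.Ioo (0:ℝ) 1} →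
      EqOn Z.integrand (fun x => 1 / (1 - x 0 * x 1 * x 2)) Z.domain →
      of r' - 2 • of Z ∈ relations) ∧
    (∃ Z : IntegralRep 3, Z.domain = {x | ∀ i, x i ∈ Set.Ioo (0:ℝ) 1} ∧
      Z.integrand = fun x => 1 / (1 - x 0 * x 1 * x 2)) :=
  ⟨ebd3_duality, ebd3_split, ebd3_double, ebd3_exists_zetaThreeBox⟩

end Summit.KontsevichZagierPeriods.HurwitzMicroSectors.NormalFormPrinciple.PiBox.M3
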